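import Summits.QuantumFields.YangMills.Theorems.FluctuationComparisonRegPrIntLWregInterior
import Summits.QuantumFields.YangMills.Theorems.AlphaInputsT3ACMinimiserPin
import HarnessLib

/-!
# S2β · POS∘ — THE TAYLOR HALF (T2d): THE TWO LOCAL ROWS OF THE COVER, `histGood ∈ 𝓝 U₀` and «`descendTo` continuous near `U₀`», in the small-threshold regime

Cell `ym3-torus` (YM ladder rung R3 = continuum `SU(2)` Yang–Mills on the three-torus at fixed lattice data — a RUNG: NOT d = 4, NOT infinite volume,
NOT a mass gap, NOT Clay).  Width seat `ym3-torus-px21` (gen 18); (T)-chain of px8 g18's pen «Taylor half»: ✓(T1) `…S2BetaGrowthOfHessianPos`, (T2a) `…S2BetaPosCollarOfGrowthRow`,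
(T2b) `…S2BetaPosCollarCoverOfTubeChart`, (T2c) `…S2BetaTubeGrowthOfHessianPos`.  Crux `stmt-QuantumFields-20520` (`…Theses.UnitScaleTilt.FluctuationComparisonRegPrIntL`),
LINE g18-1 S2β; `--kind proof --supports stmt-QuantumFields-20520 --as helper`, count-neutral, DEFINITION-FREE (0 `def`, 0 `instance`, 0 `notation`, 0 `sorry`, default heartbeats).

WHAT.  (T2b)'s cover theorem displays two LOCAL rows at the base point `U₀`; this file discharges both in the regime the lane already uses:
* ★ `histGood_mem_nhds` — `hopen : histGood F ℰp θ K J ∈ 𝓝 U₀` for `U₀ ∈ histGood`, when `θ i ≤ δ₁` with `((d+2)L)²∕4·δ₁ ≤ δ_2∕2` (✓`…WregInterior.isOpen_histGood`);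
* ★★ `eventually_continuousAt_descendTo_of_plaqSmall` — `hcont : ∀ᶠ W in 𝓝 U₀, ContinuousAt (descendTo F ℰp J K hJK) W` for `U₀` in the SHARP regular plaquette class
  `PlaqSmall (regThreshold F J K ε₀) U₀` (print's (2), first clause — e.g. `U₀ ∈ regFibrePr`), when `2ε₀` is an admissible Prop-2 radius
  (`143·(49∕4)²·(2ε₀) ≤ 1∕3`, `4ε₀ ≤ 2δ_2∕(7L)²`): the class is open (✓`Node00.isOpen_plaqSmall`) and ✓`…MinimiserPin.continuousAt_descendTo_of_plaqLe` applies at each of its points;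
  `eventually_continuousAt_descendTo_of_mem_regFibrePr` — the same from `U₀ ∈ regFibrePr F J K hJK ε₀ V`.

HONEST: regime bookkeeping; HESS∘, ISOL∘(δ), TUBE-REG∘, GAP♯∘, GAP♭, EXW∘, S2β, crux 20520 NOT proved; no summit statement is proved by a helper; finite-volume ∕ conditional;
rung R3 = SU(2) YM₃ on T³ — NOT d = 4, NOT infinite volume, NOT a mass gap, NOT Clay; the Yang–Mills mass gap is NOT proved.  Sorry-free, axioms standard.

References: T. Bałaban, CMP **102** (1985) 255–275 [Balaban1985UV3] ((7) p.257); CMP **98** (1985) 17–51 [Balaban1985Averaging] (Prop. 2 (52)–(54) p.26); CMP **102** (1985) 277–309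
[Balaban1985Variational] ((2), (6) p.278); CMP **109** (1987) 249–301 [Balaban1987RG1] ((0.11) p.253).
-/

set_option autoImplicit false

noncomputable section

namespace Summit.QuantumFields.YangMills.Theorems.FluctuationComparisonRegPrIntLS2BetaPosCollarLocalRows

open Set Filter Topology
open Literature.MathematicalPhysics.QuantumFieldTheory.Balaban1983to89
open Literature.MathematicalPhysics.QuantumFieldTheory.Balaban1983to89.T3ContinuumYM3Torus
open Literature.MathematicalPhysics.QuantumFieldTheory.Balaban1983to89.T3UnitLawDensityEML (ℰp)
open Literature.MathematicalPhysics.QuantumFieldTheory.Balaban1983to89.T3UnitScaleTilt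
open Literature.MathematicalPhysics.QuantumFieldTheory.Balaban1983to89.T3TiltDescent
open Literature.MathematicalPhysics.QuantumFieldTheory.Balaban1983to89.T3RegularMinimiser (regThreshold)
open Literature.MathematicalPhysics.QuantumFieldTheory.Balaban1983to89.T3PrintedRegularMinimiser
open Literature.MathematicalPhysics.QuantumFieldTheory.Balaban1983to89.ExpMeanLog (deltaSU)
open Summit.QuantumFields.YangMills.Theorems.FluctuationComparisonRegPrIntLWregInterior (isOpen_histGood)
open Literature.MathematicalPhysics.QuantumFieldTheory.Balaban1983to89.Node00 (isOpen_plaqSmall)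
open Summit.QuantumFields.YangMills.Theorems.MinimiserPin (continuousAt_descendTo_of_plaqLe)

variable (F : T3Family) {J K : ℕ} (hJK : J ≤ K)

include hJK in
/-- ★ **`histGood ∈ 𝓝 U₀`** for a good history `U₀`, in the small-threshold regime `θ i ≤ δ₁`, `((d+2)L)²∕4·δ₁ ≤ δ_2∕2` (the event is open there, ✓`isOpen_histGood`).
[cite: Balaban1985UV3, (7) p.257] -/
theorem histGood_mem_nhds {θ : ℕ → ℝ} {δ₁ : ℝ} (hδ₁ : 0 ≤ δ₁) (hθ : ∀ i, θ i ≤ δ₁)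
    (hsmall : (((((F.P K).d + 2) * (F.P K).L : ℕ) : ℝ) ^ 2 / 4) * δ₁ ≤ deltaSU (Fin 2) / 2)
    {U₀ : GaugeField (F.P K) 0 (Matrix.specialUnitaryGroup (Fin 2) ℂ)} (hU₀ : U₀ ∈ histGood F ℰp θ K J) :
    histGood F ℰp θ K J ∈ 𝓝 U₀ :=
  (isOpen_histGood F hδ₁ hθ hsmall hJK).mem_nhds hU₀

/-- ★★ **`descendTo` IS CONTINUOUS AT EVERY POINT NEAR A SHARPLY REGULAR `U₀`**: if every plaquette variable of `U₀` is within `regThreshold F J K ε₀ = ε₀·L^{−2(K−J)}` of `1` (print's (2),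
first clause) and `2ε₀` is an admissible Prop-2 radius, then `∀ᶠ W in 𝓝 U₀, ContinuousAt (descendTo F ℰp J K hJK) W` — the sharp class is open and the descent is continuous at each
of its points. [cite: Balaban1987RG1, (0.11) p.253; Balaban1985Averaging, Prop. 2 (52)-(54) p.26; Balaban1985Variational, (2) p.278] -/
theorem eventually_continuousAt_descendTo_of_plaqSmall {ε₀ : ℝ} (hε₀ : 0 < ε₀)
    (hr3 : (143 * ((((3 + 4 : ℕ) : ℝ)) ^ 2 / 4) ^ 2) * (2 * ε₀) ≤ 1 / 3)
    (hr2 : 2 * (2 * ε₀) ≤ 2 * deltaSU (Fin 2) / (((3 + 4) * F.L : ℕ) : ℝ) ^ 2)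
    {U₀ : GaugeField (F.P K) 0 (Matrix.specialUnitaryGroup (Fin 2) ℂ)} (hU₀ : PlaqSmall (regThreshold F J K ε₀) U₀) :
    ∀ᶠ W in 𝓝 U₀, ContinuousAt (descendTo F ℰp J K hJK) W := by
  have hO : IsOpen {W : GaugeField (F.P K) 0 (Matrix.specialUnitaryGroup (Fin 2) ℂ) | PlaqSmall (regThreshold F J K ε₀) W} :=
    isOpen_plaqSmall (P := F.P K) (j := 0) (N := 2) _
  filter_upwards [hO.mem_nhds hU₀] with W hW
  exact continuousAt_descendTo_of_plaqLe F J K hJK hε₀ hr3 hr2 le_rfl fun p => (hW p).le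

/-- The same from membership in print's regular fibre `regFibrePr` (its first clause is the sharp plaquette class). [cite: Balaban1985Variational, (2), (6) p.278] -/
theorem eventually_continuousAt_descendTo_of_mem_regFibrePr {ε₀ : ℝ} (hε₀ : 0 < ε₀)
    (hr3 : (143 * ((((3 + 4 : ℕ) : ℝ)) ^ 2 / 4) ^ 2) * (2 * ε₀) ≤ 1 / 3)
    (hr2 : 2 * (2 * ε₀) ≤ 2 * deltaSU (Fin 2) / (((3 + 4) * F.L : ℕ) : ℝ) ^ 2)
    {V : GaugeField (F.P J) 0 (Matrix.specialUnitaryGroup (Fin 2) ℂ)} {U₀ : GaugeField (F.P K) 0 (Matrix.specialUnitaryGroup (Fin 2) ℂ)}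
    (hU₀ : U₀ ∈ regFibrePr F J K hJK ε₀ V) :
    ∀ᶠ W in 𝓝 U₀, ContinuousAt (descendTo F ℰp J K hJK) W :=
  eventually_continuousAt_descendTo_of_plaqSmall F hJK hε₀ hr3 hr2 ((mem_regFibrePr_iff F).1 hU₀).2.1

end Summit.QuantumFields.YangMills.Theorems.FluctuationComparisonRegPrIntLS2BetaPosCollarLocalRows

end
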